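import Summits.QuantumFields.QCD.Theorems.SpectralDefectExtinctionWindowExtinctionStubInertiaMonotoneAux
import Summits.QuantumFields.QCD.Theorems.WindowExtinction.Negative.SpectralFlowLocal
import HarnessLib

/-!
# Supersymmetric block splitting (1/4): quadratic forms in coordinates and the block algebra of
# `[[K, Zᴴ],[Z, −K′]]`

Support file 1 of 4 for stub S14 `stub_blockSplitting` ("THM A", the abstract supersymmetric
block-splitting index theorem) of line `free-volume-heavy-witness` (reshape r6, lead c4) of crux
`Summit.QuantumFields.QCD.Theses.SpectralDefectExtinction.WindowExtinction`
(item stmt-QuantumFields-8964).  Everything here is elementary finite-dimensional linear algebra over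
`ℂ`, written in the quadratic-form language of the line (`Σ_i ‖(M v)_i‖²`, `Re v†Mv`):

* polarisation `Σ‖a+b‖² = Σ‖a‖² + Σ‖b‖² + 2 Re a†b`, Cauchy–Schwarz `|a†b| ≤ ‖a‖ ‖b‖` (through
  `EuclideanSpace`), the crude triangle bounds `Σ‖a+b‖² ≤ 2(…)`, `Σ‖a+b+c+d‖² ≤ 4(…)`, the reverse
  triangle inequality, Pythagoras for orthogonal vectors;
* `bs_adjoint_bound` — a quadratic-form bound `‖Mv‖ ≤ θ‖v‖` passes to `Mᴴ` (no operator norm needed);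
  `bs_gap_add` — `‖Av‖ ≥ σ‖v‖`, `‖Ev‖ ≤ e‖v‖` give `‖(A+E)v‖ ≥ (σ−e)‖v‖`; `bs_abs_re_form_le`;
  `bs_exists_form_bound` (some `κ` with `|Re v†Γv| ≤ κ‖v‖²`, from the `ℓ²` operator norm);
* the block algebra of the splitting `𝓗 = M_low + N₀ + Γ_h + E` of `𝓗 = [[K, Zᴴ],[Z, −K′]]` with
  respect to `Π = P ⊕ P′` (`bs_split`; the products `M_low N₀ = M_low Γ_h = M_low Πᗮ = N₀ Π = Γ_h Π = 0`;
  `Π` is an orthogonal projection of trace `2r`).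

Files 2–4 (`…StubBlockSplittingPerturb`, `…StubBlockSplittingHigh`, `…StubBlockSplitting`) build the
inertia statements on top.  Reference for the linear algebra: Horn–Johnson, *Matrix Analysis* (1985),
§4.3 (Weyl), §4.5 (Sylvester); Kato, *Perturbation Theory for Linear Operators*, I.§6 and II.§5
(stability of spectral counts under small symmetric perturbations).
-/

noncomputable section

namespace Summit.QuantumFields.QCD.Cruxes.WindowExtinction.FreeVolumeHeavyWitness

open Matrix
open Summit.QuantumFields.QCD.Theorems.ExtinctionBuildsQCD.Negative
open Summit.QuantumFields.QCD.Theorems.WindowExtinction.Negative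
open scoped BigOperators ComplexConjugate

section QuadraticForms

variable {n : Type*} [Fintype n]

/-- Polarisation: `Σ‖(a+b)_i‖² = Σ‖a_i‖² + Σ‖b_i‖² + 2 Re(a† b)`. -/
theorem bs_sum_norm_sq_add (a b : n → ℂ) :
    ∑ i, ‖(a + b) i‖ ^ 2 = ∑ i, ‖a i‖ ^ 2 + ∑ i, ‖b i‖ ^ 2 + 2 * (star a ⬝ᵥ b).re := by
  have hc : (star a ⬝ᵥ b).re = (star b ⬝ᵥ a).re := by
    rw [star_dotProduct, Complex.star_def, Complex.conj_re]
  rw [← re_star_dotProduct_self, ← re_star_dotProduct_self, ← re_star_dotProduct_self, star_add,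
    add_dotProduct, dotProduct_add, dotProduct_add, Complex.add_re, Complex.add_re, Complex.add_re, hc]
  ring

/-- `Σ‖(a-b)_i‖² = Σ‖a_i‖² + Σ‖b_i‖² - 2 Re(a† b)`. -/
theorem bs_sum_norm_sq_sub (a b : n → ℂ) :
    ∑ i, ‖(a - b) i‖ ^ 2 = ∑ i, ‖a i‖ ^ 2 + ∑ i, ‖b i‖ ^ 2 - 2 * (star a ⬝ᵥ b).re := by
  rw [sub_eq_add_neg, bs_sum_norm_sq_add, dotProduct_neg, Complex.neg_re]
  simp only [Pi.neg_apply, norm_neg]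
  ring

/-- Cauchy–Schwarz for the real part of `a† b`: `|Re(a† b)| ≤ √(Σ‖a_i‖²) · √(Σ‖b_i‖²)`
(through the inner product of `EuclideanSpace ℂ n`). -/
theorem bs_abs_re_dot_le (a b : n → ℂ) :
    |(star a ⬝ᵥ b).re| ≤ Real.sqrt (∑ i, ‖a i‖ ^ 2) * Real.sqrt (∑ i, ‖b i‖ ^ 2) := by
  refine (Complex.abs_re_le_norm _).trans ?_
  have h : star a ⬝ᵥ b = inner ℂ (WithLp.toLp 2 a : EuclideanSpace ℂ n) (WithLp.toLp 2 b) := by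
    rw [EuclideanSpace.inner_eq_star_dotProduct, dotProduct_comm]
  rw [h]
  refine (norm_inner_le_norm _ _).trans_eq ?_
  rw [EuclideanSpace.norm_eq, EuclideanSpace.norm_eq]

/-- `Σ‖v_i‖² = (√Σ‖v_i‖²)²`. -/
theorem bs_sum_norm_sq_eq_sqrt_sq (v : n → ℂ) :
    ∑ i, ‖v i‖ ^ 2 = Real.sqrt (∑ i, ‖v i‖ ^ 2) ^ 2 :=
  (Real.sq_sqrt (Finset.sum_nonneg fun i _ => by positivity)).symm

/-- Pythagoras: orthogonal vectors add their `Σ‖·‖²`. -/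
theorem bs_sum_norm_sq_add_of_dot_eq_zero {a b : n → ℂ} (h : star a ⬝ᵥ b = 0) :
    ∑ i, ‖(a + b) i‖ ^ 2 = ∑ i, ‖a i‖ ^ 2 + ∑ i, ‖b i‖ ^ 2 := by
  rw [bs_sum_norm_sq_add, h, Complex.zero_re, mul_zero, add_zero]

/-- `Σ‖(a+b)_i‖² ≤ 2 (Σ‖a_i‖² + Σ‖b_i‖²)`. -/
theorem bs_sum_norm_sq_add_le (a b : n → ℂ) :
    ∑ i, ‖(a + b) i‖ ^ 2 ≤ 2 * (∑ i, ‖a i‖ ^ 2 + ∑ i, ‖b i‖ ^ 2) := by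
  rw [bs_sum_norm_sq_add]
  have h := bs_abs_re_dot_le a b
  have ha := bs_sum_norm_sq_eq_sqrt_sq a
  have hb := bs_sum_norm_sq_eq_sqrt_sq b
  have h1 := (le_abs_self _).trans h
  nlinarith [sq_nonneg (Real.sqrt (∑ i, ‖a i‖ ^ 2) - Real.sqrt (∑ i, ‖b i‖ ^ 2))]

/-- `Σ‖(a+b+c+d)_i‖² ≤ 4 (Σ‖a_i‖² + Σ‖b_i‖² + Σ‖c_i‖² + Σ‖d_i‖²)`. -/
theorem bs_sum_norm_sq_add_four_le (a b c d : n → ℂ) :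
    ∑ i, ‖(a + b + c + d) i‖ ^ 2 ≤
      4 * (∑ i, ‖a i‖ ^ 2 + ∑ i, ‖b i‖ ^ 2 + ∑ i, ‖c i‖ ^ 2 + ∑ i, ‖d i‖ ^ 2) := by
  have h1 := bs_sum_norm_sq_add_le (a + b) (c + d)
  have h2 := bs_sum_norm_sq_add_le a b
  have h3 := bs_sum_norm_sq_add_le c d
  rw [add_assoc (a + b)] at *
  linarith

/-- A lower bound `Σ‖(a+b)_i‖² ≥ (√Σ‖a_i‖² − √Σ‖b_i‖²)²` (reverse triangle inequality, squared). -/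
theorem bs_sqrt_sub_sq_le_sum_norm_sq_add (a b : n → ℂ) :
    (Real.sqrt (∑ i, ‖a i‖ ^ 2) - Real.sqrt (∑ i, ‖b i‖ ^ 2)) ^ 2 ≤ ∑ i, ‖(a + b) i‖ ^ 2 := by
  rw [bs_sum_norm_sq_add]
  have h := bs_abs_re_dot_le a b
  have ha := bs_sum_norm_sq_eq_sqrt_sq a
  have hb := bs_sum_norm_sq_eq_sqrt_sq b
  have h1 := (neg_le_abs _).trans h
  nlinarith

/-- `x† (Mᴴ y) = (M x)† y`. -/
theorem bs_dot_conjTranspose_mulVec (M : Matrix n n ℂ) (x y : n → ℂ) :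
    star x ⬝ᵥ (Mᴴ *ᵥ y) = star (M *ᵥ x) ⬝ᵥ y := by
  rw [star_mulVec, dotProduct_mulVec]

/-- **Gap under a small perturbation (quadratic-form version)**: `‖Av‖ ≥ σ‖v‖`, `‖Ev‖ ≤ e‖v‖`,
`0 ≤ e ≤ σ` give `‖(A + E)v‖ ≥ (σ − e)‖v‖`. -/
theorem bs_gap_add {A E : Matrix n n ℂ} {σ e : ℝ} (he : 0 ≤ e) (heσ : e ≤ σ)
    (hA : ∀ v : n → ℂ, σ ^ 2 * ∑ i, ‖v i‖ ^ 2 ≤ ∑ i, ‖(A *ᵥ v) i‖ ^ 2)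
    (hE : ∀ v : n → ℂ, ∑ i, ‖(E *ᵥ v) i‖ ^ 2 ≤ e ^ 2 * ∑ i, ‖v i‖ ^ 2) (v : n → ℂ) :
    (σ - e) ^ 2 * ∑ i, ‖v i‖ ^ 2 ≤ ∑ i, ‖((A + E) *ᵥ v) i‖ ^ 2 := by
  rw [add_mulVec]
  refine le_trans ?_ (bs_sqrt_sub_sq_le_sum_norm_sq_add (A *ᵥ v) (E *ᵥ v))
  set y := Real.sqrt (∑ i, ‖v i‖ ^ 2) with hy
  have hy0 : 0 ≤ y := Real.sqrt_nonneg _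
  have hyy := bs_sum_norm_sq_eq_sqrt_sq v
  have hσ : 0 ≤ σ := he.trans heσ
  have hAv : σ * y ≤ Real.sqrt (∑ i, ‖(A *ᵥ v) i‖ ^ 2) := by
    rw [hy, ← Real.sqrt_sq hσ, ← Real.sqrt_mul (sq_nonneg σ)]
    exact Real.sqrt_le_sqrt (hA v)
  have hEv : Real.sqrt (∑ i, ‖(E *ᵥ v) i‖ ^ 2) ≤ e * y := by
    rw [hy, ← Real.sqrt_sq he, ← Real.sqrt_mul (sq_nonneg e)]
    exact Real.sqrt_le_sqrt (hE v)
  have h1 : (σ - e) * y ≤ Real.sqrt (∑ i, ‖(A *ᵥ v) i‖ ^ 2) - Real.sqrt (∑ i, ‖(E *ᵥ v) i‖ ^ 2) := by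
    linarith
  have h0 : 0 ≤ (σ - e) * y := mul_nonneg (by linarith) hy0
  calc (σ - e) ^ 2 * ∑ i, ‖v i‖ ^ 2 = ((σ - e) * y) ^ 2 := by rw [hyy]; ring
    _ ≤ _ := pow_le_pow_left₀ h0 h1 2

/-- The form of a Hermitian matrix is controlled by its quadratic-form bound:
`|Re v†Ev| ≤ e Σ‖v_i‖²` when `Σ‖(Ev)_i‖² ≤ e² Σ‖v_i‖²`. -/
theorem bs_abs_re_form_le {E : Matrix n n ℂ} {e : ℝ} (he : 0 ≤ e)
    (hE : ∀ v : n → ℂ, ∑ i, ‖(E *ᵥ v) i‖ ^ 2 ≤ e ^ 2 * ∑ i, ‖v i‖ ^ 2) (v : n → ℂ) :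
    |(star v ⬝ᵥ (E *ᵥ v)).re| ≤ e * ∑ i, ‖v i‖ ^ 2 := by
  refine (bs_abs_re_dot_le v (E *ᵥ v)).trans ?_
  have hEv : Real.sqrt (∑ i, ‖(E *ᵥ v) i‖ ^ 2) ≤ e * Real.sqrt (∑ i, ‖v i‖ ^ 2) := by
    rw [← Real.sqrt_sq he, ← Real.sqrt_mul (sq_nonneg e)]
    exact Real.sqrt_le_sqrt (hE v)
  calc Real.sqrt (∑ i, ‖v i‖ ^ 2) * Real.sqrt (∑ i, ‖(E *ᵥ v) i‖ ^ 2)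
      ≤ Real.sqrt (∑ i, ‖v i‖ ^ 2) * (e * Real.sqrt (∑ i, ‖v i‖ ^ 2)) :=
        mul_le_mul_of_nonneg_left hEv (Real.sqrt_nonneg _)
    _ = e * (Real.sqrt (∑ i, ‖v i‖ ^ 2) * Real.sqrt (∑ i, ‖v i‖ ^ 2)) := by ring
    _ = e * ∑ i, ‖v i‖ ^ 2 := by
        rw [Real.mul_self_sqrt (Finset.sum_nonneg fun i _ => by positivity)]

open scoped Matrix.Norms.L2Operator in
/-- Every matrix has SOME form bound `|Re v†Γv| ≤ κ Σ‖v_i‖²` with `κ > 0` (the `ℓ²` operator norm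
plus one). -/
theorem bs_exists_form_bound [DecidableEq n] (Γ : Matrix n n ℂ) :
    ∃ κ : ℝ, 0 < κ ∧ ∀ v : n → ℂ, |(star v ⬝ᵥ (Γ *ᵥ v)).re| ≤ κ * ∑ i, ‖v i‖ ^ 2 := by
  refine ⟨‖Γ‖ + 1, by positivity, fun v => ?_⟩
  have h0 : 0 ≤ ∑ i, ‖v i‖ ^ 2 := Finset.sum_nonneg fun i _ => by positivity
  calc |(star v ⬝ᵥ (Γ *ᵥ v)).re| ≤ ‖star v ⬝ᵥ (Γ *ᵥ v)‖ := Complex.abs_re_le_norm _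
    _ ≤ ‖Γ‖ * ∑ i, ‖v i‖ ^ 2 := norm_star_dotProduct_mulVec_le Γ v
    _ ≤ (‖Γ‖ + 1) * ∑ i, ‖v i‖ ^ 2 := by nlinarith

end QuadraticForms

/-- **A quadratic-form bound passes to the adjoint**: if `Σ‖(Mv)_i‖² ≤ θ² Σ‖v_i‖²` for all `v`, then
the same holds for `Mᴴ` (`‖Mᴴv‖² = Re v†(M Mᴴ v) ≤ ‖v‖ θ ‖Mᴴ v‖`). -/
theorem bs_adjoint_bound : ∀ {n : Type*} [Fintype n] {M : Matrix n n ℂ} {θ : ℝ}, 0 ≤ θ → (∀ v : n → ℂ, ∑ i, ‖(M *ᵥ v) i‖ ^ 2 ≤ θ ^ 2 * ∑ i, ‖v i‖ ^ 2) → ∀ v : n → ℂ, ∑ i, ‖(Mᴴ *ᵥ v) i‖ ^ 2 ≤ θ ^ 2 * ∑ i, ‖v i‖ ^ 2 := by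
  intro n _ M θ hθ h v
  have h1 : ∑ i, ‖(Mᴴ *ᵥ v) i‖ ^ 2 = (star v ⬝ᵥ (M *ᵥ (Mᴴ *ᵥ v))).re := by
    rw [← re_star_dotProduct_self, ← bs_dot_conjTranspose_mulVec, conjTranspose_conjTranspose]
  have hMw : Real.sqrt (∑ i, ‖(M *ᵥ (Mᴴ *ᵥ v)) i‖ ^ 2) ≤
      θ * Real.sqrt (∑ i, ‖(Mᴴ *ᵥ v) i‖ ^ 2) := by
    rw [← Real.sqrt_sq hθ, ← Real.sqrt_mul (sq_nonneg θ)]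
    exact Real.sqrt_le_sqrt (h _)
  have hxx := bs_sum_norm_sq_eq_sqrt_sq (Mᴴ *ᵥ v)
  have hyy := bs_sum_norm_sq_eq_sqrt_sq v
  have h2 : Real.sqrt (∑ i, ‖(Mᴴ *ᵥ v) i‖ ^ 2) ^ 2 ≤ Real.sqrt (∑ i, ‖v i‖ ^ 2) *
      (θ * Real.sqrt (∑ i, ‖(Mᴴ *ᵥ v) i‖ ^ 2)) := by
    calc Real.sqrt (∑ i, ‖(Mᴴ *ᵥ v) i‖ ^ 2) ^ 2 = (star v ⬝ᵥ (M *ᵥ (Mᴴ *ᵥ v))).re :=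
          hxx.symm.trans h1
      _ ≤ |(star v ⬝ᵥ (M *ᵥ (Mᴴ *ᵥ v))).re| := le_abs_self _
      _ ≤ Real.sqrt (∑ i, ‖v i‖ ^ 2) * Real.sqrt (∑ i, ‖(M *ᵥ (Mᴴ *ᵥ v)) i‖ ^ 2) :=
          bs_abs_re_dot_le _ _
      _ ≤ _ := mul_le_mul_of_nonneg_left hMw (Real.sqrt_nonneg _)
  generalize hx : Real.sqrt (∑ i, ‖(Mᴴ *ᵥ v) i‖ ^ 2) = x at hxx h2
  generalize hy : Real.sqrt (∑ i, ‖v i‖ ^ 2) = y at hyy h2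
  have hx0 : 0 ≤ x := hx ▸ Real.sqrt_nonneg _
  have hy0 : 0 ≤ y := hy ▸ Real.sqrt_nonneg _
  rw [hxx, hyy]
  rcases hx0.lt_or_eq with hxp | hx0'
  · have h3 : x ≤ θ * y := by nlinarith
    calc x ^ 2 ≤ (θ * y) ^ 2 := pow_le_pow_left₀ hx0 h3 2
      _ = θ ^ 2 * y ^ 2 := by ring
  · rw [← hx0', zero_pow two_ne_zero]
    positivity

section BlockAlgebra

variable {ι : Type*} [Fintype ι] [DecidableEq ι]

/-- `P (1 − P) = 0` for an idempotent. -/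
theorem bs_proj_mul_compl {P : Matrix ι ι ℂ} (hP2 : P * P = P) : P * (1 - P) = 0 := by
  rw [Matrix.mul_sub, Matrix.mul_one, hP2, sub_self]

/-- `(1 − P) P = 0` for an idempotent. -/
theorem bs_compl_mul_proj {P : Matrix ι ι ℂ} (hP2 : P * P = P) : (1 - P) * P = 0 := by
  rw [Matrix.sub_mul, Matrix.one_mul, hP2, sub_self]

/-- `P ((1 − P) X) = 0`. -/
theorem bs_proj_mul_compl_mul {P : Matrix ι ι ℂ} (hP2 : P * P = P) (X : Matrix ι ι ℂ) :
    P * ((1 - P) * X) = 0 := by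
  rw [← Matrix.mul_assoc, bs_proj_mul_compl hP2, Matrix.zero_mul]

/-- `(1 − P) (P X) = 0`. -/
theorem bs_compl_mul_proj_mul {P : Matrix ι ι ℂ} (hP2 : P * P = P) (X : Matrix ι ι ℂ) :
    (1 - P) * (P * X) = 0 := by
  rw [← Matrix.mul_assoc, bs_compl_mul_proj hP2, Matrix.zero_mul]

/-- `(1 − P)² = 1 − P`. -/
theorem bs_compl_mul_compl {P : Matrix ι ι ℂ} (hP2 : P * P = P) : (1 - P) * (1 - P) = 1 - P := by
  rw [Matrix.sub_mul, Matrix.one_mul, Matrix.mul_sub, Matrix.mul_one, hP2, sub_self, sub_zero]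

/-- `(1 − P) ((1 − P) X) = (1 − P) X`. -/
theorem bs_compl_mul_compl_mul {P : Matrix ι ι ℂ} (hP2 : P * P = P) (X : Matrix ι ι ℂ) :
    (1 - P) * ((1 - P) * X) = (1 - P) * X := by
  rw [← Matrix.mul_assoc, bs_compl_mul_compl hP2]

omit [DecidableEq ι] in
/-- `P (P X) = P X`. -/
theorem bs_proj_mul_proj_mul {P : Matrix ι ι ℂ} (hP2 : P * P = P) (X : Matrix ι ι ℂ) :
    P * (P * X) = P * X := by
  rw [← Matrix.mul_assoc, hP2]

omit [Fintype ι] in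
/-- `(1 − P)ᴴ = 1 − P` for Hermitian `P`. -/
theorem bs_compl_conjTranspose {P : Matrix ι ι ℂ} (hP : P.IsHermitian) :
    (1 - P)ᴴ = 1 - P := by
  rw [conjTranspose_sub, conjTranspose_one, hP.eq]

/-- **The splitting** `𝓗 = M_low + (N₀ + Γ_h) + E` of `𝓗 = [[K, Zᴴ],[Z, −K′]]` into the low block
`Π𝓗Π`, the high block `Πᗮ𝓗Πᗮ = N₀ + Γ_h` (off-diagonal part `N₀`, diagonal part `Γ_h`) and the
coupling `E = Π𝓗Πᗮ + Πᗮ𝓗Π`, for `Π = P ⊕ P′`. -/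
theorem bs_split (K K' Z P P' : Matrix ι ι ℂ) :
    fromBlocks K Zᴴ Z (-K') =
      fromBlocks (P * K * P) (P * Zᴴ * P') (P' * Z * P) (-(P' * K' * P')) +
        fromBlocks 0 ((1 - P) * Zᴴ * (1 - P')) ((1 - P') * Z * (1 - P)) 0 +
        fromBlocks ((1 - P) * K * (1 - P)) 0 0 (-((1 - P') * K' * (1 - P'))) +
      fromBlocks (P * K * (1 - P) + (1 - P) * K * P) (P * Zᴴ * (1 - P') + (1 - P) * Zᴴ * P')
        (P' * Z * (1 - P) + (1 - P') * Z * P) (-(P' * K' * (1 - P') + (1 - P') * K' * P')) := by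
  simp only [fromBlocks_add]
  congr 1
  · simp only [Matrix.sub_mul, Matrix.mul_sub, Matrix.one_mul, Matrix.mul_one]; abel
  · simp only [Matrix.sub_mul, Matrix.mul_sub, Matrix.one_mul, Matrix.mul_one]; abel
  · simp only [Matrix.sub_mul, Matrix.mul_sub, Matrix.one_mul, Matrix.mul_one]; abel
  · simp only [Matrix.sub_mul, Matrix.mul_sub, Matrix.one_mul, Matrix.mul_one]; abel

/-- `M_low · N₀ = 0`. -/
theorem bs_low_mul_N0 (K K' Z : Matrix ι ι ℂ) {P P' : Matrix ι ι ℂ} (hP2 : P * P = P)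
    (hP'2 : P' * P' = P') :
    fromBlocks (P * K * P) (P * Zᴴ * P') (P' * Z * P) (-(P' * K' * P')) *
      fromBlocks 0 ((1 - P) * Zᴴ * (1 - P')) ((1 - P') * Z * (1 - P)) 0 = 0 := by
  rw [fromBlocks_multiply]
  simp only [Matrix.mul_zero, add_zero, Matrix.neg_mul, Matrix.mul_assoc,
    bs_proj_mul_compl_mul hP2, bs_proj_mul_compl_mul hP'2, neg_zero, fromBlocks_zero]

/-- `M_low · Γ_h = 0`. -/
theorem bs_low_mul_Gam (K K' Z : Matrix ι ι ℂ) {P P' : Matrix ι ι ℂ} (hP2 : P * P = P)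
    (hP'2 : P' * P' = P') :
    fromBlocks (P * K * P) (P * Zᴴ * P') (P' * Z * P) (-(P' * K' * P')) *
      fromBlocks ((1 - P) * K * (1 - P)) 0 0 (-((1 - P') * K' * (1 - P'))) = 0 := by
  rw [fromBlocks_multiply]
  simp only [Matrix.mul_zero, add_zero, Matrix.neg_mul, Matrix.mul_neg,
    Matrix.mul_assoc, bs_proj_mul_compl_mul hP2, bs_proj_mul_compl_mul hP'2, neg_zero,
    fromBlocks_zero]

/-- `M_low · Πᗮ = 0`. -/
theorem bs_low_mul_PiC (K K' Z : Matrix ι ι ℂ) {P P' : Matrix ι ι ℂ} (hP2 : P * P = P)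
    (hP'2 : P' * P' = P') :
    fromBlocks (P * K * P) (P * Zᴴ * P') (P' * Z * P) (-(P' * K' * P')) *
      fromBlocks (1 - P) 0 0 (1 - P') = 0 := by
  rw [fromBlocks_multiply]
  simp only [Matrix.mul_zero, add_zero, Matrix.neg_mul, Matrix.mul_assoc,
    bs_proj_mul_compl hP2, bs_proj_mul_compl hP'2, neg_zero, fromBlocks_zero]

/-- `N₀ · Π = 0`. -/
theorem bs_N0_mul_Pi (Z : Matrix ι ι ℂ) {P P' : Matrix ι ι ℂ} (hP2 : P * P = P)
    (hP'2 : P' * P' = P') :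
    fromBlocks 0 ((1 - P) * Zᴴ * (1 - P')) ((1 - P') * Z * (1 - P)) 0 * fromBlocks P 0 0 P' = 0 := by
  rw [fromBlocks_multiply]
  simp only [Matrix.mul_zero, Matrix.zero_mul, add_zero, Matrix.mul_assoc,
    bs_compl_mul_proj hP2, bs_compl_mul_proj hP'2, fromBlocks_zero]

/-- `Γ_h · Π = 0`. -/
theorem bs_Gam_mul_Pi (K K' : Matrix ι ι ℂ) {P P' : Matrix ι ι ℂ} (hP2 : P * P = P)
    (hP'2 : P' * P' = P') :
    fromBlocks ((1 - P) * K * (1 - P)) 0 0 (-((1 - P') * K' * (1 - P'))) * fromBlocks P 0 0 P' = 0 := by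
  rw [fromBlocks_multiply]
  simp only [Matrix.mul_zero, Matrix.zero_mul, add_zero, Matrix.neg_mul, Matrix.mul_assoc,
    bs_compl_mul_proj hP2, bs_compl_mul_proj hP'2, neg_zero, fromBlocks_zero]

/-- `Π = P ⊕ P′` is an orthogonal projection of trace `2r`. -/
theorem bs_Pi_proj {P P' : Matrix ι ι ℂ} (hP : P.IsHermitian) (hP2 : P * P = P) (hP' : P'.IsHermitian)
    (hP'2 : P' * P' = P') {r : ℕ} (htr : P.trace = r) (htr' : P'.trace = r) :
    (fromBlocks P 0 0 P').IsHermitian ∧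
      fromBlocks P 0 0 P' * fromBlocks P 0 0 P' = fromBlocks P 0 0 P' ∧
      (fromBlocks P 0 0 P').trace = ((r + r : ℕ) : ℂ) ∧
      1 - fromBlocks P 0 0 P' = fromBlocks (1 - P) 0 0 (1 - P') := by
  refine ⟨hP.fromBlocks conjTranspose_zero hP', ?_, ?_, ?_⟩
  · rw [fromBlocks_multiply]
    simp [hP2, hP'2]
  · simp [Matrix.trace, Fintype.sum_sum_type, fromBlocks] at htr htr' ⊢
    rw [htr, htr']
  · rw [← fromBlocks_one, sub_eq_add_neg, fromBlocks_neg, fromBlocks_add]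
    simp [sub_eq_add_neg]

omit [DecidableEq ι] in
/-- `Σ‖·‖²` of a vector on `ι ⊕ ι` splits into its two halves. -/
theorem bs_sum_sq_sum (w : ι ⊕ ι → ℂ) :
    ∑ i, ‖w i‖ ^ 2 = ∑ i, ‖w (Sum.inl i)‖ ^ 2 + ∑ i, ‖w (Sum.inr i)‖ ^ 2 :=
  Fintype.sum_sum_type _

omit [DecidableEq ι] in
/-- `Σ‖·‖²` of `Sum.elim a b`. -/
theorem bs_sum_sq_elim (a b : ι → ℂ) :
    ∑ i, ‖Sum.elim a b i‖ ^ 2 = ∑ i, ‖a i‖ ^ 2 + ∑ i, ‖b i‖ ^ 2 := by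
  rw [Fintype.sum_sum_type]
  simp only [Sum.elim_inl, Sum.elim_inr]

omit [Fintype ι] [DecidableEq ι] in
/-- `star` of `Sum.elim`. -/
theorem bs_star_sumElim (a b : ι → ℂ) : star (Sum.elim a b) = Sum.elim (star a) (star b) := by
  funext i
  rcases i with i | i <;> rfl

end BlockAlgebra

end Summit.QuantumFields.QCD.Cruxes.WindowExtinction.FreeVolumeHeavyWitness

end
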